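import Literature.Probability.ImportanceSampling.ChatterjeeDiaconis

/-!
# The sample size required by the SELF-NORMALISED importance sampling estimate `J_n(f)`
# (Chatterjee–Diaconis 2018, Theorem 1.2)

HONEST FRAMING: exact (Metropolis-corrected) sampling algorithms for lattice gauge theory;
figures of merit are autocorrelation/cost numbers at stated couplings and volumes; no
continuum-physics claim.

Topic `Literature/Probability/ImportanceSampling`; sequel of `ChatterjeeDiaconis.lean` (Theorem 1.1,
the unnormalised estimate `I_n(f)`), whose PROVED named fact `ChatterjeeDiaconis2018_sampleSize`
is the only input; everything below is proved, no named fact, no axiom.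

Source (READ), VERBATIM [cite: ChatterjeeDiaconis2018, §1 eq. (jndef), Thm 1.2 and §3 (proof)]
(S. Chatterjee, P. Diaconis, *The sample size required in importance sampling*, Ann. Appl. Probab.
28 (2018) 1099–1135 = arXiv:1511.01437, held text `paper:arxiv-1511.01437` p0003–p0004, p0012):
"`J_n(f) := Σ_{i=1}^n f(X_i) τ(X_i) / Σ_{i=1}^n τ(X_i)`" (with `τ` any known multiple of `ρ =
dν/dμ`; `J_n` does not depend on the multiple).  **"Theorem 1.2.** Let all notation be as in
Theorem 1.1 and let `J_n(f)` be the estimate defined in (jndef). Suppose that `n = exp(L + t)` for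
some `t ≥ 0`. Let `ε := (e^{−t/4} + 2√(P(log ρ(Y) > L + t/2)))^{1/2}`. Then
`P(|J_n(f) − I(f)| ≥ 2‖f‖_{L²(ν)} ε/(1 − ε)) ≤ 2ε`.
Conversely, suppose that `n = exp(L − t)` for some `t ≥ 0`. Let `f(x)` denote the function from
`𝒳` into `ℝ` that is equal to `1` when `log ρ(x) ≤ L − t/2` and `0` otherwise. Then
`I(f) = P(log ρ(Y) ≤ L − t/2)` and `P(J_n(f) ≠ 1) ≤ e^{−t/2}`."
PROOF (§3, verbatim skeleton): "let `a = e^{L+t/2}` … `b := √(a/n) + 2√(P(ρ(Y) > a))`. Then by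
Theorem 1.1, for any `ε, δ ∈ (0,1)`, `P(|I_n(1) − 1| ≥ ε) ≤ b/ε` and
`P(|I_n(f) − I(f)| ≥ δ) ≤ ‖f‖_{L²(ν)} b/δ`. Now, if `|I_n(f) − I(f)| < δ` and `|I_n(1) − 1| < ε`,
then `|J_n(f) − I(f)| = |I_n(f)/I_n(1) − I(f)| ≤ (|I_n(f) − I(f)| + |I(f)||1 − I_n(1)|)/I_n(1) <
(δ + |I(f)| ε)/(1 − ε)`. Taking `ε = √b` and `δ = ‖f‖_{L²(ν)} ε` completes the proof of the first
inequality … Note that if `ε` turns out to be bigger than `1`, then the bound is true anyway.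
Next, suppose that `n = e^{L−t}` and let `a = e^{L−t/2}`. Let `f(x) = 1` if `ρ(x) ≤ a` and `0`
otherwise. Then `I(f) = P(ρ(Y) ≤ a)` and by (rhoineq), `P(J_n(f) ≠ 1) ≤ Σ_{i=1}^n P(ρ(X_i) > a) ≤
n/a`."

Lean reading (as in `ChatterjeeDiaconis.lean`: the sample is `x : Fin n → 𝓧` under `μ^{⊗n} =
Measure.pi`, `ρ = (ν.rnDeriv μ).toReal`, `L = ∫ log ρ dν`, `I_n = isEstimate`):
* `snEstimate μ ν f n x = Σ_i f(x i)ρ(x i) / Σ_i ρ(x i)` — `J_n(f)`; `snEstimate_eq_div`: `J_n(f) =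
  I_n(f)/I_n(1)` (Lean's `0/0 = 0` convention makes `J_n = 0` on the `μ^{⊗n}`-possible event
  `Σ_i ρ(x i) = 0`, where the printed `J_n` is undefined).
* The quantity `b` is taken, as in the tree's Theorem 1.1, in the form
  `b = e^{−t/4} + 2√(ν{L + t/2 < log ρ})` (for `n ≥ e^{L+t}` one has `√(a/n) ≤ e^{−t/4}`, which is
  how the tree's Theorem 1.1 states its bound; the printed `ε` IS `√b` with this `b`).
* **`ChatterjeeDiaconis2018_thm_1_2`** — the first display, for every `n ≥ e^{L+t}` (the printed
  `n = e^{L+t}` is the special case), under the standing hypotheses of Theorem 1.1 (`ν ≪ μ`,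
  `f ∈ L²(ν)` measurable) AND `‖f‖_{L²(ν)} > 0` — a TYPING NOTE: for `‖f‖_{L²(ν)} = 0` the printed
  threshold is `0` and the printed inequality reads `1 ≤ 2ε`, false for small `ε` (`J_n(f) = I(f) = 0`
  a.s.); the paper's statement tacitly excludes this degenerate case.
* **`measureReal_exists_gt_le_exp`** and **`snEstimate_indicator_eq_one`** — the second display:
  for `n ≤ e^{L−t}` and `a = e^{L−t/2}`, the event "some sampled point has `ρ(X_i) > a`" has
  probability `≤ e^{−t/2}`, and off that event `J_n(f) = 1` for `f = 1{ρ ≤ a}` as soon as the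
  normalising sum `Σ_i ρ(X_i)` is non-zero (the printed "`P(J_n(f) ≠ 1) ≤ n/a ≤ e^{−t/2}`", with
  Lean's division convention made explicit); `integral_indicator_le_eq` — `I(f) = ν{ρ ≤ a}`.

Context (cell pub-lqcd, HOME/R2-SCOPE.md §3 E6 / barrier B1 "volume scaling of reweighting",
`reweight` exactness mode): the REWEIGHT-mode estimator of a flow sampler is exactly `J_n` (weights
known up to the constant `Z`); Theorem 1.2 says its sample-size requirement is the same
`n ≈ exp(D(ν‖μ))` as for `I_n` — self-normalisation does not evade the Kullback–Leibler barrier.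
-/

noncomputable section

namespace Literature.Probability.ImportanceSampling

open _root_.MeasureTheory _root_.ProbabilityTheory Set

universe u

variable {𝓧 : Type u} [MeasurableSpace 𝓧]

/-- The SELF-NORMALISED importance sampling estimate `J_n(f)(x) = Σ_i f(x i)ρ(x i) / Σ_i ρ(x i)`
(`= Σ f τ/Σ τ` for any known multiple `τ` of `ρ`). [cite: ChatterjeeDiaconis2018, §1 eq. (jndef)] -/
def snEstimate (μ ν : Measure 𝓧) (f : 𝓧 → ℝ) (n : ℕ) (x : Fin n → 𝓧) : ℝ :=
  (∑ i, f (x i) * (ν.rnDeriv μ (x i)).toReal) / ∑ i, (ν.rnDeriv μ (x i)).toReal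

/-- `J_n(f) = I_n(f)/I_n(1)` ("`|J_n(f) − I(f)| = |I_n(f)/I_n(1) − I(f)|`").
[cite: ChatterjeeDiaconis2018, §3 (proof of Thm 1.2, first display of the chain)] -/
theorem snEstimate_eq_div (μ ν : Measure 𝓧) (f : 𝓧 → ℝ) (n : ℕ) (x : Fin n → 𝓧) :
    snEstimate μ ν f n x = isEstimate μ ν f n x / isEstimate μ ν (fun _ => (1 : ℝ)) n x := by
  unfold snEstimate isEstimate
  rcases Nat.eq_zero_or_pos n with hn | hn
  · subst hn
    simp
  · have hn' : (n : ℝ) ≠ 0 := by exact_mod_cast hn.ne'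
    simp only [one_mul]
    rw [mul_div_mul_left _ _ (one_div_ne_zero hn')]

section Proof

variable {μ ν : Measure 𝓧} [IsProbabilityMeasure μ] [IsProbabilityMeasure ν]

/-- `ρ`, read in `ℝ`. [cite: ChatterjeeDiaconis2018, §1 ("probability density of `ν` with respect
to `μ`")] -/
private def densR (μ ν : Measure 𝓧) (y : 𝓧) : ℝ := (ν.rnDeriv μ y).toReal

omit [IsProbabilityMeasure μ] [IsProbabilityMeasure ν] in
/-- `ρ` is measurable. [cite: ChatterjeeDiaconis2018, §1 ("probability density of `ν` with respect
to `μ`")] -/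
private lemma measurable_densR : Measurable (densR μ ν) :=
  (Measure.measurable_rnDeriv ν μ).ennreal_toReal

omit [IsProbabilityMeasure μ] [IsProbabilityMeasure ν] in
/-- `ρ ≥ 0`. [cite: ChatterjeeDiaconis2018, §1 ("probability density")] -/
private lemma densR_nonneg (y : 𝓧) : 0 ≤ densR μ ν y := ENNReal.toReal_nonneg

/-- marginal integral `∫ g(x i) dμ^{⊗n} = ∫ g dμ`. [cite: ChatterjeeDiaconis2018, §1 ("`X_1, …, X_n`
i.i.d. `μ`")] -/
private lemma integral_eval (n : ℕ) (i : Fin n) {g : 𝓧 → ℝ} (hg : AEStronglyMeasurable g μ) :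
    ∫ x, g (x i) ∂(Measure.pi (fun _ : Fin n => μ)) = ∫ y, g y ∂μ := by
  have hmp := measurePreserving_eval (fun _ : Fin n => μ) i
  have h1 : ∫ y, g y ∂((Measure.pi (fun _ : Fin n => μ)).map (Function.eval i)) =
      ∫ x, g (Function.eval i x) ∂(Measure.pi (fun _ : Fin n => μ)) := by
    apply integral_map (measurable_pi_apply i).aemeasurable
    rw [hmp.map_eq]
    exact hg
  rw [hmp.map_eq] at h1
  rw [h1]

/-- `f ρ ∈ L¹(μ)` for `f ∈ L²(ν)` (`⊂ L¹(ν)`). [cite: ChatterjeeDiaconis2018, §1 ("`I(f)` … finite")] -/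
private lemma integrable_mul_densR (hνμ : ν ≪ μ) {f : 𝓧 → ℝ} (hf2 : MemLp f 2 ν) :
    Integrable (fun y => f y * densR μ ν y) μ := by
  have h := (integrable_toReal_rnDeriv_mul_iff hνμ (f := f)).mpr (hf2.integrable one_le_two)
  refine h.congr (ae_of_all _ fun y => ?_)
  simp [densR, mul_comm]

/-- `I_n(f)` is integrable under `μ^{⊗n}`. [cite: ChatterjeeDiaconis2018, Thm 1.1 (`E|I_n(f) − I(f)|`
is a finite expectation)] -/
private lemma integrable_isEstimate (hνμ : ν ≪ μ) {f : 𝓧 → ℝ} (hf2 : MemLp f 2 ν) (n : ℕ) :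
    Integrable (isEstimate μ ν f n) (Measure.pi (fun _ : Fin n => μ)) := by
  unfold isEstimate
  refine Integrable.const_mul (integrable_finsetSum _ fun i _ => ?_) _
  have hG := integrable_mul_densR hνμ hf2
  exact ((measurePreserving_eval (fun _ : Fin n => μ) i).integrable_comp
    hG.aestronglyMeasurable).mpr hG

/-- `|I(f)| ≤ ‖f‖_{L²(ν)}` (Cauchy–Schwarz on the probability space `(𝒳, ν)`).
[cite: ChatterjeeDiaconis2018, §3 (proof of Thm 1.2: "`δ + |I(f)| ε`" with `δ = ‖f‖ ε`)] -/
private lemma abs_integral_le_sqrt {f : 𝓧 → ℝ} (hf2 : MemLp f 2 ν) :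
    |∫ y, f y ∂ν| ≤ Real.sqrt (∫ y, f y ^ 2 ∂ν) := by
  have hv := variance_nonneg f ν
  rw [variance_eq_sub hf2] at hv
  simp only [Pi.pow_apply] at hv
  calc |∫ y, f y ∂ν| = Real.sqrt ((∫ y, f y ∂ν) ^ 2) := (Real.sqrt_sq_eq_abs _).symm
    _ ≤ Real.sqrt (∫ y, f y ^ 2 ∂ν) := Real.sqrt_le_sqrt (by linarith)

/-- Markov from Theorem 1.1: `P(|I_n(f) − I(f)| ≥ δ) ≤ ‖f‖_{L²(ν)} b/δ`.
[cite: ChatterjeeDiaconis2018, §3 (proof of Thm 1.2, the two displays after "by Theorem 1.1")] -/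
private lemma markov_isEstimate (hνμ : ν ≪ μ) {f : 𝓧 → ℝ} (hf : Measurable f) (hf2 : MemLp f 2 ν)
    {t : ℝ} (ht : 0 ≤ t) {n : ℕ}
    (hn : Real.exp ((∫ y, Real.log (ν.rnDeriv μ y).toReal ∂ν) + t) ≤ (n : ℝ)) {δ : ℝ} (hδ : 0 < δ) :
    (Measure.pi (fun _ : Fin n => μ)).real
        {x | δ ≤ |isEstimate μ ν f n x - ∫ y, f y ∂ν|} ≤
      Real.sqrt (∫ y, f y ^ 2 ∂ν) * (Real.exp (-t / 4) +
        2 * Real.sqrt (ν {y | (∫ z, Real.log (ν.rnDeriv μ z).toReal ∂ν) + t / 2 <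
          Real.log (ν.rnDeriv μ y).toReal}).toReal) / δ := by
  have h11 := (ChatterjeeDiaconis2018_sampleSize_holds 𝓧 μ ν hνμ f hf hf2 t ht).1 n hn
  have hint : Integrable (fun x => |isEstimate μ ν f n x - ∫ y, f y ∂ν|)
      (Measure.pi (fun _ : Fin n => μ)) :=
    ((integrable_isEstimate hνμ hf2 n).sub (integrable_const _)).abs
  have hM := mul_meas_ge_le_integral_of_nonneg (ae_of_all _ fun x => abs_nonneg _) hint δ
  rw [le_div_iff₀ hδ, mul_comm]
  exact hM.trans h11

/-- **THEOREM 1.2 (Chatterjee–Diaconis), first display**: for `n ≥ e^{L+t}`, `t ≥ 0`,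
`ε = (e^{−t/4} + 2√(ν{log ρ > L + t/2}))^{1/2}`, and `f ∈ L²(ν)` with `‖f‖_{L²(ν)} > 0`,
`P(|J_n(f) − I(f)| ≥ 2‖f‖_{L²(ν)} ε/(1 − ε)) ≤ 2ε`.
[cite: ChatterjeeDiaconis2018, Thm 1.2 (first display); §3 (proof)] -/
theorem ChatterjeeDiaconis2018_thm_1_2 (hνμ : ν ≪ μ) {f : 𝓧 → ℝ} (hf : Measurable f)
    (hf2 : MemLp f 2 ν) (hfpos : 0 < ∫ y, f y ^ 2 ∂ν) {t : ℝ} (ht : 0 ≤ t) {n : ℕ}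
    (hn : Real.exp ((∫ y, Real.log (ν.rnDeriv μ y).toReal ∂ν) + t) ≤ (n : ℝ)) :
    let ε : ℝ := Real.sqrt (Real.exp (-t / 4) +
        2 * Real.sqrt (ν {y | (∫ z, Real.log (ν.rnDeriv μ z).toReal ∂ν) + t / 2 <
          Real.log (ν.rnDeriv μ y).toReal}).toReal)
    (Measure.pi (fun _ : Fin n => μ)).real
        {x | 2 * Real.sqrt (∫ y, f y ^ 2 ∂ν) * ε / (1 - ε) ≤
          |snEstimate μ ν f n x - ∫ y, f y ∂ν|} ≤ 2 * ε := by
  intro ε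
  set P : Measure (Fin n → 𝓧) := Measure.pi (fun _ : Fin n => μ) with hP
  set b : ℝ := Real.exp (-t / 4) +
      2 * Real.sqrt (ν {y | (∫ z, Real.log (ν.rnDeriv μ z).toReal ∂ν) + t / 2 <
        Real.log (ν.rnDeriv μ y).toReal}).toReal with hb
  set nf : ℝ := Real.sqrt (∫ y, f y ^ 2 ∂ν) with hnf
  have hb0 : 0 < b := by positivity
  have hεb : ε = Real.sqrt b := rfl
  have hε0 : 0 < ε := Real.sqrt_pos.mpr hb0
  have hε2 : ε ^ 2 = b := Real.sq_sqrt hb0.le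
  have hnf0 : 0 < nf := Real.sqrt_pos.mpr hfpos
  -- "if `ε` turns out to be bigger than `1`, then the bound is true anyway"
  by_cases hε1 : 1 ≤ ε
  · calc P.real _ ≤ 1 := measureReal_le_one
      _ ≤ 2 * ε := by linarith
  rw [not_le] at hε1
  -- the two Markov bounds: `P(A) ≤ ‖f‖ b/δ = ε` (`δ = ‖f‖ ε`) and `P(B) ≤ b/ε = ε`
  set A : Set (Fin n → 𝓧) := {x | nf * ε ≤ |isEstimate μ ν f n x - ∫ y, f y ∂ν|} with hA
  set B : Set (Fin n → 𝓧) := {x | ε ≤ |isEstimate μ ν (fun _ => (1 : ℝ)) n x - 1|} with hB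
  have hPA : P.real A ≤ ε := by
    have h := markov_isEstimate hνμ hf hf2 ht hn (mul_pos hnf0 hε0)
    calc P.real A ≤ nf * b / (nf * ε) := h
      _ = ε := by rw [← hε2]; field_simp
  have hPB : P.real B ≤ ε := by
    have h := markov_isEstimate (μ := μ) (ν := ν) hνμ (f := fun _ => (1 : ℝ)) measurable_const
      (memLp_const 1) ht hn hε0
    simp only [one_pow, integral_const, probReal_univ, smul_eq_mul, mul_one,
      Real.sqrt_one, one_mul] at h
    calc P.real B = P.real {x | ε ≤ |isEstimate μ ν (fun _ => (1 : ℝ)) n x - 1|} := rfl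
      _ ≤ b / ε := h
      _ = ε := by rw [← hε2]; field_simp
  -- the inclusion: off `A ∪ B`, `|J_n(f) − I(f)| < (δ + |I(f)| ε)/(1 − ε) ≤ 2‖f‖ε/(1 − ε)`
  have hIf : |∫ y, f y ∂ν| ≤ nf := abs_integral_le_sqrt hf2
  have hsub : {x | 2 * nf * ε / (1 - ε) ≤ |snEstimate μ ν f n x - ∫ y, f y ∂ν|} ⊆ A ∪ B := by
    intro x hx
    by_contra hxAB
    rw [Set.mem_union, not_or] at hxAB
    obtain ⟨hxA, hxB⟩ := hxAB
    simp only [hA, hB, Set.mem_setOf_eq, not_le] at hxA hxB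
    set In := isEstimate μ ν f n x with hIn
    set I1 := isEstimate μ ν (fun _ => (1 : ℝ)) n x with hI1
    set If := ∫ y, f y ∂ν with hIfd
    have hI1pos : 1 - ε < I1 := by
      have := (abs_lt.mp hxB).1
      linarith
    have hI1pos' : 0 < I1 := by linarith
    have hJ : snEstimate μ ν f n x = In / I1 := snEstimate_eq_div μ ν f n x
    -- `|In/I1 − If| = |In − If·I1|/I1 ≤ (|In − If| + |If| |1 − I1|)/I1`
    have hnum : |In - If * I1| ≤ |In - If| + |If| * |1 - I1| := by
      calc |In - If * I1| = |(In - If) + If * (1 - I1)| := by ring_nf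
        _ ≤ |In - If| + |If * (1 - I1)| := abs_add_le _ _
        _ = |In - If| + |If| * |1 - I1| := by rw [abs_mul]
    have hnum_lt : |In - If| + |If| * |1 - I1| < nf * ε + nf * ε := by
      have h2 : |If| * |1 - I1| ≤ nf * ε := by
        rw [abs_sub_comm] at hxB
        exact mul_le_mul hIf hxB.le (abs_nonneg _) hnf0.le
      linarith
    have hkey : |snEstimate μ ν f n x - If| < 2 * nf * ε / (1 - ε) := by
      rw [hJ, show In / I1 - If = (In - If * I1) / I1 by field_simp, abs_div,
        abs_of_pos hI1pos']
      have h1ε : 0 < 1 - ε := by linarith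
      calc |In - If * I1| / I1 ≤ |In - If * I1| / (1 - ε) :=
            div_le_div_of_nonneg_left (abs_nonneg _) h1ε hI1pos.le
        _ < (nf * ε + nf * ε) / (1 - ε) := by
            exact div_lt_div_of_pos_right (hnum.trans_lt hnum_lt) h1ε
        _ = 2 * nf * ε / (1 - ε) := by ring
    exact (not_le.mpr hkey) hx
  calc P.real {x | 2 * nf * ε / (1 - ε) ≤ |snEstimate μ ν f n x - ∫ y, f y ∂ν|}
      ≤ P.real (A ∪ B) := measureReal_mono hsub
    _ ≤ P.real A + P.real B := measureReal_union_le A B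
    _ ≤ 2 * ε := by linarith

/-! ### The converse display -/

omit [IsProbabilityMeasure μ] [IsProbabilityMeasure ν] in
/-- `I(f) = ν{ρ ≤ a}` for `f = 1{ρ ≤ a}` ("Then `I(f) = P(ρ(Y) ≤ a)`").
[cite: ChatterjeeDiaconis2018, Thm 1.2 (second display) and §3 (proof)] -/
theorem integral_indicator_le_eq (a : ℝ) :
    ∫ y, ({y | (ν.rnDeriv μ y).toReal ≤ a} : Set 𝓧).indicator (fun _ => (1 : ℝ)) y ∂ν =
      ν.real {y | (ν.rnDeriv μ y).toReal ≤ a} := by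
  have hS : MeasurableSet ({y | (ν.rnDeriv μ y).toReal ≤ a} : Set 𝓧) :=
    measurableSet_le (Measure.measurable_rnDeriv ν μ).ennreal_toReal measurable_const
  rw [integral_indicator_const _ hS]
  simp

/-- **THEOREM 1.2, second display (the bad event)**: for `n ≤ e^{L−t}` and `a = e^{L−t/2}`,
`P(∃ i, ρ(X_i) > a) ≤ Σ_i P(ρ(X_i) > a) ≤ n/a ≤ e^{−t/2}` (Markov under `μ`: `μ{ρ > a} ≤ 1/a`,
since `∫ ρ dμ = 1`). [cite: ChatterjeeDiaconis2018, Thm 1.2 (second display) and §3 (proof: "by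
(rhoineq), `P(J_n(f) ≠ 1) ≤ Σ_{i=1}^n P(ρ(X_i) > a) ≤ n/a`")] -/
theorem measureReal_exists_gt_le_exp (hνμ : ν ≪ μ) {t : ℝ} {n : ℕ}
    (hn : (n : ℝ) ≤ Real.exp ((∫ y, Real.log (ν.rnDeriv μ y).toReal ∂ν) - t)) :
    (Measure.pi (fun _ : Fin n => μ)).real
        {x | ∃ i, Real.exp ((∫ y, Real.log (ν.rnDeriv μ y).toReal ∂ν) - t / 2) <
          (ν.rnDeriv μ (x i)).toReal} ≤ Real.exp (-t / 2) := by
  set L := ∫ y, Real.log (ν.rnDeriv μ y).toReal ∂ν with hL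
  set a := Real.exp (L - t / 2) with ha
  have ha0 : 0 < a := Real.exp_pos _
  have hS : MeasurableSet {y | a < densR μ ν y} := measurableSet_lt measurable_const measurable_densR
  -- Markov under `μ`: `a μ{a < ρ} ≤ a μ{a ≤ ρ} ≤ ∫ ρ dμ = 1`
  have hmarkov : μ.real {y | a < densR μ ν y} ≤ 1 / a := by
    have hint : Integrable (densR μ ν) μ := Measure.integrable_toReal_rnDeriv
    have h1 : a * μ.real {y | a ≤ densR μ ν y} ≤ ∫ y, densR μ ν y ∂μ :=
      mul_meas_ge_le_integral_of_nonneg (ae_of_all _ fun y => densR_nonneg y) hint a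
    have h2 : ∫ y, densR μ ν y ∂μ = 1 := by
      calc ∫ y, densR μ ν y ∂μ = ν.real Set.univ := Measure.integral_toReal_rnDeriv hνμ
        _ = 1 := probReal_univ
    have h3 : μ.real {y | a < densR μ ν y} ≤ μ.real {y | a ≤ densR μ ν y} :=
      measureReal_mono fun y hy => by
        simp only [Set.mem_setOf_eq] at hy ⊢
        exact hy.le
    rw [le_div_iff₀ ha0, mul_comm]
    have h4 : a * μ.real {y | a < densR μ ν y} ≤ a * μ.real {y | a ≤ densR μ ν y} :=
      mul_le_mul_of_nonneg_left h3 ha0.le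
    linarith
  have hset : {x : Fin n → 𝓧 | ∃ i, a < densR μ ν (x i)} = ⋃ i, {x | x i ∈ {y | a < densR μ ν y}} := by
    ext x; simp
  calc (Measure.pi (fun _ : Fin n => μ)).real {x | ∃ i, a < (ν.rnDeriv μ (x i)).toReal}
      = (Measure.pi (fun _ : Fin n => μ)).real (⋃ i, {x | x i ∈ {y | a < densR μ ν y}}) := by
        rw [← hset]; rfl
    _ ≤ ∑ i, (Measure.pi (fun _ : Fin n => μ)).real {x | x i ∈ {y | a < densR μ ν y}} :=
        measureReal_iUnion_fintype_le _
    _ = ∑ _i : Fin n, μ.real {y | a < densR μ ν y} := by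
        refine Finset.sum_congr rfl fun i _ => ?_
        have hm : (Measure.pi (fun _ : Fin n => μ)) {x | x i ∈ {y | a < densR μ ν y}} =
            μ {y | a < densR μ ν y} :=
          (measurePreserving_eval (fun _ : Fin n => μ) i).measure_preimage hS.nullMeasurableSet
        rw [measureReal_def, measureReal_def, hm]
    _ ≤ ∑ _i : Fin n, 1 / a := Finset.sum_le_sum fun i _ => hmarkov
    _ = n / a := by simp [div_eq_mul_inv]
    _ ≤ Real.exp (L - t) / a := by gcongr
    _ = Real.exp (-t / 2) := by
        rw [ha, ← Real.exp_sub]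
        congr 1
        ring

omit [IsProbabilityMeasure μ] [IsProbabilityMeasure ν] in
/-- … and OFF that event `J_n(f) = 1` for `f = 1{ρ ≤ a}`, as soon as the normalising sum is non-zero
(every sampled weight is kept: numerator = denominator). [cite: ChatterjeeDiaconis2018, §3 (proof of
Thm 1.2, second display: "`P(J_n(f) ≠ 1) ≤ Σ P(ρ(X_i) > a)`")] -/
theorem snEstimate_indicator_eq_one (a : ℝ) (n : ℕ) (x : Fin n → 𝓧)
    (hx : ∀ i, (ν.rnDeriv μ (x i)).toReal ≤ a) (hpos : ∑ i, (ν.rnDeriv μ (x i)).toReal ≠ 0) :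
    snEstimate μ ν (({y | (ν.rnDeriv μ y).toReal ≤ a} : Set 𝓧).indicator fun _ => (1 : ℝ)) n x
      = 1 := by
  unfold snEstimate
  have hnum : ∑ i, ({y | (ν.rnDeriv μ y).toReal ≤ a} : Set 𝓧).indicator (fun _ => (1 : ℝ)) (x i) *
      (ν.rnDeriv μ (x i)).toReal = ∑ i, (ν.rnDeriv μ (x i)).toReal := by
    refine Finset.sum_congr rfl fun i _ => ?_
    rw [Set.indicator_of_mem (show x i ∈ {y | (ν.rnDeriv μ y).toReal ≤ a} from hx i), one_mul]
  rw [hnum, div_self hpos]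

end Proof

end Literature.Probability.ImportanceSampling

end
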